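import Literature.AlgebraicGeometry.Resolution.ExcellentRings
import Mathlib.RingTheory.Etale.Basic
import Mathlib.RingTheory.Smooth.Basic
import Mathlib.RingTheory.FiniteType
import Mathlib.RingTheory.Ideal.Quotient.Operations
import HarnessLib

/-!
# General Néron desingularisation (Popescu) and étale lifting of sections (Stacks 07M7)

Topic: `Literature/AlgebraicGeometry/Resolution`. The two ring-theoretic inputs of the proof of
M. Artin's algebraic approximation theorem in its étale-neighbourhood form (Artin 1969,
Cor. 2.1 = `Artin1969EtaleApproximation`; Stacks, Tag 07QZ) as it is proved in the Stacks
Project (chapter *Smoothing Ring Maps*, Thm. 13.2 = Tag 07QZ, whose printed proof reads: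
Popescu's theorem 07GC gives a factorisation `A → B → R^` with `B` smooth; *More on Algebra*,
Lemma 9.14 = Tag 07M7 turns the section `B → κ` into an étale `R → R'` with trivial residue
extension and an `R`-map `B → R'`). Both are theories of their own (Popescu–Ogoma–Swan–André;
lifting of projective modules and idempotents along étale maps) and absent from Mathlib; they
are vendored here as NAMED FACTS, stated with Mathlib's `Algebra.Smooth` / `Algebra.Etale` /
`Algebra.FiniteType` and the tree's `IsRegularHom` (`ExcellentRings.lean`, Matsumura's "regular
homomorphism": flat with geometrically regular fibres).

* `Popescu1986_generalNeronDesingularization` — NAMED FACT, **Popescu 1986, Thm. (2.5),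
  (i) ⇒ (ii)** ("General Néron desingularization"; Stacks 07GC; Swan 1998): for a regular
  morphism `u : A → A'` of Noetherian rings, every `A`-morphism `f : B → A'` from a finite type
  `A`-algebra `B` factors `B → C → A'` through a smooth `A`-algebra `C`.
* `Stacks07M7_etaleLift` — NAMED FACT, **Stacks, Tag 07M7** (*More on Algebra*, Lemma 9.14):
  for a ring `A`, an ideal `I ⊆ A` and a smooth `A`-algebra `B` with an `A`-algebra map
  `B → A/I`, there is an étale ring map `A → A'` inducing an isomorphism `A/I → A'/IA'` and an
  `A`-algebra map `B → A'` lifting `B → A/I`.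

## Rendering notes

* Popescu's (ii) asks for a *standard smooth* `A`-algebra `C` (a localisation
  `(A[Y]/(g))_P`, `P` a maximal minor of the Jacobian of `g`, p. 88); standard smooth algebras
  are smooth, so the statement vendored here (with Mathlib's `Algebra.Smooth A C`: formally
  smooth and finitely presented) is implied by the printed one; it is the form in which the
  theorem is quoted and used in Stacks 07QY/07QZ ("there exists a factorization `A → B → R^`
  with `B` smooth over `R`, see Theorem 12.1 [= 07GC]"). Popescu's "regular morphism" (p. 85:
  flat with geometrically regular fibres, for Noetherian rings) is `IsRegularHom`.
* The proof in Popescu 1986 has a gap repaired in Popescu 1990 (*Letter to the editor*); complete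
  published proofs: Ogoma 1994, Swan 1998, Stacks 07GC. The statement is undisputed.
* In `Stacks07M7_etaleLift`, "induces an isomorphism `A/I → A'/IA'`" is rendered as bijectivity
  of `Ideal.quotientMap (I A') (A → A')`, and "lifting the ring map `B → A/I`" as the equality of
  the two composites `B → A' → A'/IA'` and `B → A/I → A'/IA'`.
* Universes: all rings in one universe `u`; the algebras `C`, `A'` produced are of finite type
  over `A`, so asking for them in `Type u` loses nothing.

## Sources

* D. Popescu, *General Néron desingularization and approximation*, Nagoya Math. J. 104 (1986)
  85–115: §2, Thm. (2.5) p. 89, with the definition of desingularization p. 88 [Popescu1986];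
  *Letter to the editor*, Nagoya Math. J. 118 (1990) 45–53 [Popescu1990].
* The Stacks Project: Tag 07GC (Smoothing Ring Maps, Thm. 12.1), Tag 07M7 (More on Algebra,
  Lemma 9.14), Tags 07QY, 07QZ (Smoothing Ring Maps, Thms. 13.1, 13.2) [StacksProject].
* M. Artin, *Algebraic approximation of structures over complete local rings*, Publ. Math.
  IHÉS 36 (1969), Cor. 2.1 [Artin1969] (the user: `ArtinApproximation.lean`).
-/

noncomputable section

namespace Literature.AlgebraicGeometry.Resolution

universe u

/-- NAMED FACT — **Popescu's General Néron desingularisation** (Popescu 1986, Thm. (2.5),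
(i) ⇒ (ii); Stacks 07GC): "Let `u : A → A'` be a morphism of noetherian rings. Then the
following conditions are equivalent: i) `u` is regular, ii) for every finite type `A`-algebra
`B` and every `A`-morphism `f : B → A'` the couple `(B, f)` has a desingularization with respect
to `u`" — where (p. 88) "the couple `(B, f)` has a desingularization with respect to `u` if
there exist a standard smooth `A`-algebra `B'` and two `A`-morphisms `v : B → B'`,
`w : B' → A'` such that `wv = f`." Rendered with `C = B'` merely smooth (`Algebra.Smooth A C`),
which the printed statement implies. Users take `(h : Popescu1986_generalNeronDesingularization)`.
[cite: Popescu1986, Thm. 2.5 (i)⇒(ii), p. 89] -/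
def Popescu1986_generalNeronDesingularization : Prop :=
  ∀ (A A' : Type u) [CommRing A] [CommRing A'] [Algebra A A'],
    IsNoetherianRing A → IsNoetherianRing A' → IsRegularHom A A' →
      ∀ (B : Type u) [CommRing B] [Algebra A B], Algebra.FiniteType A B →
        ∀ (f : B →ₐ[A] A'),
          ∃ (C : Type u) (_ : CommRing C) (_ : Algebra A C),
            Algebra.Smooth A C ∧ ∃ (v : B →ₐ[A] C) (w : C →ₐ[A] A'), w.comp v = f

/-- NAMED FACT — **Stacks, Tag 07M7** (*More on Algebra*, Lemma 9.14): "Let `A` be a ring, let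
`I ⊂ A` be an ideal. Consider a commutative diagram `A → B → A/I` [i.e. an `A`-algebra map
`B → A/I`] where `B` is a smooth `A`-algebra. Then there exists an étale ring map `A → A'`
which induces an isomorphism `A/I → A'/IA'` and an `A`-algebra map `B → A'` lifting the ring
map `B → A/I`." Rendered: `Algebra.Etale A A'`; the canonical `A/I → A'/IA'`
(`Ideal.quotientMap`) is bijective; and for the lift `τ : B →ₐ[A] A'`, the class of `τ b` in
`A'/IA'` is the image of `σ b ∈ A/I`. Users take `(h : Stacks07M7_etaleLift)`.
[cite: StacksProject, Tag 07M7] -/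
def Stacks07M7_etaleLift : Prop :=
  ∀ (A : Type u) [CommRing A] (I : Ideal A) (B : Type u) [CommRing B] [Algebra A B],
    Algebra.Smooth A B →
      ∀ (σ : B →ₐ[A] A ⧸ I),
        ∃ (A' : Type u) (_ : CommRing A') (_ : Algebra A A'),
          Algebra.Etale A A' ∧
            Function.Bijective
              (Ideal.quotientMap (I.map (algebraMap A A')) (algebraMap A A')
                Ideal.le_comap_map) ∧
            ∃ (τ : B →ₐ[A] A'),
              ∀ b : B,
                Ideal.Quotient.mk (I.map (algebraMap A A')) (τ b) =
                  Ideal.quotientMap (I.map (algebraMap A A')) (algebraMap A A')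
                    Ideal.le_comap_map (σ b)

/-! ## Elementary consequences and sanity checks -/

/-- The trivial case of Popescu's theorem, PROVED: if `B` is itself smooth over `A`, the couple
`(B, f)` is desingularised by `B` (take `C = B`, `v = id`, `w = f`). [folklore] -/
theorem exists_smooth_factorisation_of_smooth {A A' B : Type u} [CommRing A] [CommRing A']
    [Algebra A A'] [CommRing B] [Algebra A B] [Algebra.Smooth A B] (f : B →ₐ[A] A') :
    ∃ (C : Type u) (_ : CommRing C) (_ : Algebra A C),
      Algebra.Smooth A C ∧ ∃ (v : B →ₐ[A] C) (w : C →ₐ[A] A'), w.comp v = f :=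
  ⟨B, inferInstance, inferInstance, ‹_›, AlgHom.id A B, f, AlgHom.comp_id f⟩

/-- The trivial case of Stacks 07M7, PROVED: if the section `B → A/I` already lifts to an
`A`-algebra map `τ : B → A`, then `A' = A` (étale over itself, `A/I → A/IA` the identity) does
it. [folklore] -/
theorem exists_etaleLift_of_lift {A B : Type u} [CommRing A] (I : Ideal A) [CommRing B]
    [Algebra A B] (σ : B →ₐ[A] A ⧸ I) (τ : B →ₐ[A] A)
    (hτ : ∀ b, Ideal.Quotient.mk I (τ b) = σ b) :
    ∃ (A' : Type u) (_ : CommRing A') (_ : Algebra A A'),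
      Algebra.Etale A A' ∧
        Function.Bijective
          (Ideal.quotientMap (I.map (algebraMap A A')) (algebraMap A A') Ideal.le_comap_map) ∧
        ∃ (τ' : B →ₐ[A] A'),
          ∀ b : B,
            Ideal.Quotient.mk (I.map (algebraMap A A')) (τ' b) =
              Ideal.quotientMap (I.map (algebraMap A A')) (algebraMap A A') Ideal.le_comap_map
                (σ b) := by
  refine ⟨A, inferInstance, inferInstance, inferInstance, ?_, τ, fun b => ?_⟩
  · have hI : I.map (algebraMap A A) = I := by simp
    constructor
    · intro x y hxy
      obtain ⟨x, rfl⟩ := Ideal.Quotient.mk_surjective x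
      obtain ⟨y, rfl⟩ := Ideal.Quotient.mk_surjective y
      rw [Ideal.quotientMap_mk, Ideal.quotientMap_mk, Ideal.Quotient.eq] at hxy
      rw [Ideal.Quotient.eq]
      simpa [hI] using hxy
    · intro x
      obtain ⟨x, rfl⟩ := Ideal.Quotient.mk_surjective x
      exact ⟨Ideal.Quotient.mk I x, by rw [Ideal.quotientMap_mk]; rfl⟩
  · rw [← hτ b, Ideal.quotientMap_mk]
    rfl

/-- In the conclusion of Stacks 07M7 the ideal `IA'` has the same quotient as `I`; in
particular, if `I = 𝔭` is prime then so is `𝔭A'` (its quotient is a domain), and `𝔭A'`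
contracts to `𝔭`. [folklore] -/
theorem isPrime_map_of_bijective_quotientMap {A A' : Type u} [CommRing A] [CommRing A']
    [Algebra A A'] (p : Ideal A) [p.IsPrime]
    (h : Function.Bijective
      (Ideal.quotientMap (p.map (algebraMap A A')) (algebraMap A A') Ideal.le_comap_map)) :
    (p.map (algebraMap A A')).IsPrime ∧ (p.map (algebraMap A A')).comap (algebraMap A A') = p := by
  set e := RingEquiv.ofBijective _ h with he
  have hprime : (p.map (algebraMap A A')).IsPrime := by
    rw [← Ideal.Quotient.isDomain_iff_prime]
    exact e.symm.toMulEquiv.isDomain (A ⧸ p)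
  refine ⟨hprime, le_antisymm (fun x hx => ?_) Ideal.le_comap_map⟩
  rw [Ideal.mem_comap] at hx
  have h1 : Ideal.quotientMap (p.map (algebraMap A A')) (algebraMap A A') Ideal.le_comap_map
      (Ideal.Quotient.mk p x) = 0 := by
    rw [Ideal.quotientMap_mk]
    exact Ideal.Quotient.eq_zero_iff_mem.mpr hx
  have h2 : Ideal.Quotient.mk p x = 0 := h.1 (by rw [h1, map_zero])
  exact Ideal.Quotient.eq_zero_iff_mem.mp h2

end Literature.AlgebraicGeometry.Resolution

end
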